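import Literature.NumberTheory.Rogawski1990.LocalTransferGlue   -- ★ p839807: `exists_transfer_of_cover`, `isDeltaTransferExistsRel_of_cover`; through it ★ `LocalTransfer` (`IsDeltaTransferRel`, `stableOrbitalIntegralRel`)
import HarnessLib

/-!
# The ONE-CHART JUNCTION for (4.3.1): a Δ-transfer of `ψ` supported in one regular chart, from an `H`-side realisation of the prescribed stable orbital
# integrals on the matching torus box and the vanishing of both sides off the box (Rogawski 1990 §4.3 (4.3.1), §4.9; Langlands–Shelstad 1987 §1.3)

Topic `NumberTheory/Rogawski1990`; namespace `Literature.NumberTheory.Rogawski1990`.  THEOREMS ONLY (no definition, no instance, no notation, no named fact, no `sorry`);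
GENERIC (abstract groups `A` («`H`»), `B` («`G′`»), matching `R`, stable conjugacy `stA`, regularity `regA`, transfer factor `T`, orbital measure families `m_H, m_G` — the
PARAMETERS of ★ `IsDeltaTransferRel`).  Cell `pub/hodgecm-mathlib` (D-0151), crux H413 = stmt-HodgeConjecture-24833, F0∕P3a road «D-N6-ns», floor-2 letter N6-ns-reg, brick
«(HLOC) JUNCTION» (LEAD F0P3a-plan (g9) T8-17 (B)(4)), GENERIC HALF; seat F0P2-p02 (g8).  HONEST LABEL: HC_CM is proved only modulo the printed citations until rung 0 closes;
this file proves no letter — it is the bookkeeping that turns «the `H`-side can REALISE the prescribed stable orbital integrals on one torus box» (F0P3a-p08 (g12) census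
`CENSUS-N6ns-reg-iv-Hside` (iv-a)(iv-b)(iv-c)) + «`Δ` is stable-class invariant in `γ_H`» ((iv-d), B-p10 (g23)) + «the right side of (4.3.1) vanishes off the box» (the `G′`-side
chart saturation, (ii)) into the per-chart hypothesis `hloc` of the glue ★ `exists_transfer_of_cover`.

THE MATHEMATICS.  Fix `ψ : B → ℂ`.  The right side of (4.3.1) is `RHS_ψ(γ_H) := Σᶠ_{[γ]} Δ(γ_H, γ) Φ([γ], ψ)`; if `Δ(·, γ)` is `stA`-invariant (print §4.3 p. 43: «`Δ_{G∕H}`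
depends only on the stable conjugacy class of `γ_H`») then so is `RHS_ψ` (§1), and the left side `Φ^st_H(γ_H, ψ^H)` is `stA`-invariant for an equivalence relation `stA`
(★ `stableOrbitalIntegralRel_congr`).  Hence (§2 `exists_transfer_of_chart`): if some `ψ^H ∈ PH` has `Φ^st_H(τ b, ψ^H) = RHS_ψ(τ b)` at every point `τ b` of a torus box
`B₁` and `Φ^st_H(γ_H, ψ^H) = 0` at every regular `γ_H` NOT stably conjugate into `τ(B₁)`, and `RHS_ψ(γ_H) = 0` at those `γ_H` too, then `ψ^H` is a Δ-transfer of `ψ`: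
at a regular `γ_H` stably conjugate to some `τ b` both sides equal their value at `τ b`; elsewhere both vanish.  §3 feeds this, chart by chart, to the glue.

* §1 `finsum_delta_mul_classOrbitalIntegral_congr_of_rel` (RHS is `stA`-invariant under `hΔst`), `stableOrbitalIntegralRel_congr_of_rel` (LHS, for `stA` symmetric and transitive).
* §2 `exists_transfer_of_chart` (THE ONE-CHART JUNCTION), `isDeltaTransferRel_of_chart` (the same for a GIVEN `ψ^H`).
* §3 `exists_transfer_of_cover_of_charts`, `isDeltaTransferExistsRel_of_charts` (every chart `U_i` carries a box `(τ_i, B_i)` with realisation + vanishing ⇒ the glue's `hloc` ⇒ transfer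
  for every `φ ∈ C_c^∞` covered by the charts).

## References
* [Rogawski1990] J. Rogawski, *Automorphic Representations of Unitary Groups in Three Variables*, Ann. of Math. Stud. 123 (1990): §4.3 (4.3.1) p. 43 («`Δ_{G∕H}(γ_H, γ)` depends only on
  the stable conjugacy class of `γ_H`»); §4.9 Prop. 4.9.1 (a) pp. 54–55; §4.1 (4.1.1) p. 39.
* [LanglandsShelstad1987] R. P. Langlands, D. Shelstad, *On the definition of transfer factors*, Math. Ann. 278 (1987): §1.3 (transfer away from the singular set).
* [HarishChandra1970] Harish-Chandra (notes by G. van Dijk), *Harmonic Analysis on Reductive p-adic Groups*, LNM 162 (1970): Part I §3.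
-/

set_option autoImplicit false

noncomputable section

open Set Filter Topology MeasureTheory

namespace Literature.NumberTheory.Rogawski1990

open Literature.NumberTheory.Automorphic

/-! ## §1 Both sides of (4.3.1) are stable-class functions of `γ_H` -/

section Invariance

variable {A B : Type*} [Group A] [Group B]
  [mA : ∀ a : A, MeasurableSpace (A ⧸ Subgroup.centralizer ({a} : Set A))]
  [mB : ∀ b : B, MeasurableSpace (B ⧸ Subgroup.centralizer ({b} : Set B))]

omit mA in
/-- **The right side of (4.3.1) is a stable-class function of `γ_H`** when `Δ(·, γ)` is: `Σᶠ_{[γ]} Δ(γ_H′, γ) Φ([γ], ψ) = Σᶠ_{[γ]} Δ(γ_H, γ) Φ([γ], ψ)` for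
`stA γ_H γ_H′`. [cite: Rogawski1990, §4.3 (4.3.1) p. 43] -/
theorem finsum_delta_mul_classOrbitalIntegral_congr_of_rel {R : A → B → Prop} {stA : A → A → Prop} (T : TransferFactorData A B R)
    (hΔst : ∀ (a a' : A) (b : B), stA a a' → T.Δ a' b = T.Δ a b) (mG : OrbitalMeasureFamily B) (ψ : B → ℂ) {a a' : A} (h : stA a a') :
    ∑ᶠ c : ConjClasses B, T.Δ a' (Quotient.out c) * classOrbitalIntegral mG ψ c =
      ∑ᶠ c : ConjClasses B, T.Δ a (Quotient.out c) * classOrbitalIntegral mG ψ c :=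
  finsum_congr fun c => by rw [hΔst a a' (Quotient.out c) h]

omit mB in
/-- **The left side of (4.3.1) is a stable-class function of `γ_H`** for a symmetric transitive `stA`: `Φ^st_H(γ_H, f^H) = Φ^st_H(γ_H′, f^H)` for `stA γ_H γ_H′`
(★ `stableOrbitalIntegralRel_congr`). [cite: Rogawski1990, §4.1 (4.1.1) p. 40] -/
theorem stableOrbitalIntegralRel_congr_of_rel {stA : A → A → Prop} (hsymm : ∀ a a', stA a a' → stA a' a)
    (htrans : ∀ a a' a'', stA a a' → stA a' a'' → stA a a'') (mH : OrbitalMeasureFamily A) (fH : A → ℂ) {a a' : A} (h : stA a a') :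
    stableOrbitalIntegralRel stA mH fH a = stableOrbitalIntegralRel stA mH fH a' :=
  stableOrbitalIntegralRel_congr (fun _ => ⟨fun he => htrans _ _ _ (hsymm _ _ h) he, fun he => htrans _ _ _ h he⟩) mH fH

end Invariance

/-! ## §2 THE ONE-CHART JUNCTION -/

section OneChart

variable {A B : Type*} [Group A] [Group B]
  [∀ a : A, MeasurableSpace (A ⧸ Subgroup.centralizer ({a} : Set A))]
  [∀ b : B, MeasurableSpace (B ⧸ Subgroup.centralizer ({b} : Set B))]

/-- **(4.3.1) for a GIVEN `ψ^H` from its values on one torus box.**  `stA` symmetric and transitive, `Δ` stable-left-invariant (`hΔst`); a «box» `τ : Bx → A`, `B₁ ⊆ Bx`.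
If `Φ^st_H(τ b, ψ^H) = RHS_ψ(τ b)` for `b ∈ B₁` (`hbox`), `Φ^st_H(γ_H, ψ^H) = 0` at every regular `γ_H` not stably conjugate into `τ(B₁)` (`hzeroH`), and `RHS_ψ(γ_H) = 0` there
too (`hzeroG`), then `ψ^H` is a Δ-transfer of `ψ`. [cite: Rogawski1990, §4.3 (4.3.1) p. 43; §4.9 p. 54] [cite: LanglandsShelstad1987, §1.3] -/
theorem isDeltaTransferRel_of_chart {R : A → B → Prop} {stA : A → A → Prop} {regA : A → Prop} {T : TransferFactorData A B R}
    {mH : OrbitalMeasureFamily A} {mG : OrbitalMeasureFamily B}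
    (hsymm : ∀ a a', stA a a' → stA a' a) (htrans : ∀ a a' a'', stA a a' → stA a' a'' → stA a a'')
    (hΔst : ∀ (a a' : A) (b : B), stA a a' → T.Δ a' b = T.Δ a b)
    {Bx : Type*} (τ : Bx → A) (B₁ : Set Bx) (ψ : B → ℂ) (ψH : A → ℂ)
    (hbox : ∀ b ∈ B₁, stableOrbitalIntegralRel stA mH ψH (τ b) = ∑ᶠ c : ConjClasses B, T.Δ (τ b) (Quotient.out c) * classOrbitalIntegral mG ψ c)
    (hzeroH : ∀ a, regA a → (∀ b ∈ B₁, ¬ stA a (τ b)) → stableOrbitalIntegralRel stA mH ψH a = 0)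
    (hzeroG : ∀ a, regA a → (∀ b ∈ B₁, ¬ stA a (τ b)) → ∑ᶠ c : ConjClasses B, T.Δ a (Quotient.out c) * classOrbitalIntegral mG ψ c = 0) :
    IsDeltaTransferRel R stA regA T mH mG ψH ψ := by
  intro a ha
  by_cases hmatch : ∃ b ∈ B₁, stA a (τ b)
  · obtain ⟨b, hb, hab⟩ := hmatch
    rw [stableOrbitalIntegralRel_congr_of_rel hsymm htrans mH ψH hab, hbox b hb,
      finsum_delta_mul_classOrbitalIntegral_congr_of_rel T hΔst mG ψ hab]
  · have hmatch' : ∀ b ∈ B₁, ¬ stA a (τ b) := fun b hb hab => hmatch ⟨b, hb, hab⟩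
    rw [hzeroH a ha hmatch', hzeroG a ha hmatch']

/-- **THE ONE-CHART JUNCTION.**  Same setting; if the `H`-side REALISES the prescribed box values — some `ψ^H ∈ PH` with `Φ^st_H(τ b, ψ^H) = RHS_ψ(τ b)` on `B₁` and `Φ^st_H(γ_H, ψ^H) = 0`
at the regular `γ_H` not stably conjugate into `τ(B₁)` (`hreal`: (iv-a)(iv-b)(iv-c) of the H-side census) — and `RHS_ψ` vanishes at those `γ_H` (`hzeroG`: the `G′`-side chart
saturation), then `ψ` has a Δ-transfer in `PH`. [cite: Rogawski1990, §4.9 Prop. 4.9.1 (a) pp. 54–55; §4.3 (4.3.1) p. 43] [cite: LanglandsShelstad1987, §1.3] -/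
theorem exists_transfer_of_chart {R : A → B → Prop} {stA : A → A → Prop} {regA : A → Prop} {T : TransferFactorData A B R}
    {mH : OrbitalMeasureFamily A} {mG : OrbitalMeasureFamily B}
    (hsymm : ∀ a a', stA a a' → stA a' a) (htrans : ∀ a a' a'', stA a a' → stA a' a'' → stA a a'')
    (hΔst : ∀ (a a' : A) (b : B), stA a a' → T.Δ a' b = T.Δ a b)
    (PH : (A → ℂ) → Prop) {Bx : Type*} (τ : Bx → A) (B₁ : Set Bx) (ψ : B → ℂ)
    (hreal : ∃ ψH : A → ℂ, PH ψH ∧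
      (∀ b ∈ B₁, stableOrbitalIntegralRel stA mH ψH (τ b) = ∑ᶠ c : ConjClasses B, T.Δ (τ b) (Quotient.out c) * classOrbitalIntegral mG ψ c) ∧
      (∀ a, regA a → (∀ b ∈ B₁, ¬ stA a (τ b)) → stableOrbitalIntegralRel stA mH ψH a = 0))
    (hzeroG : ∀ a, regA a → (∀ b ∈ B₁, ¬ stA a (τ b)) → ∑ᶠ c : ConjClasses B, T.Δ a (Quotient.out c) * classOrbitalIntegral mG ψ c = 0) :
    ∃ ψH : A → ℂ, PH ψH ∧ IsDeltaTransferRel R stA regA T mH mG ψH ψ := by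
  obtain ⟨ψH, hPH, hbox, hzeroH⟩ := hreal
  exact ⟨ψH, hPH, isDeltaTransferRel_of_chart hsymm htrans hΔst τ B₁ ψ ψH hbox hzeroH hzeroG⟩

end OneChart

/-! ## §3 Chart by chart into the glue -/

section Charts

variable {A B : Type*} [Group A] [Group B] [TopologicalSpace B] [T2Space B] [TotallyDisconnectedSpace B]
  [∀ a : A, MeasurableSpace (A ⧸ Subgroup.centralizer ({a} : Set A))]
  [∀ b : B, MeasurableSpace (B ⧸ Subgroup.centralizer ({b} : Set B))]

/-- **Transfer for one `φ` from a family of charts WITH BOXES.**  Charts `U_i ⊆ B` (open) covering `tsupport φ`; for each `i` a torus box `(τ_i, B_i)` on the `H`-side such that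
for EVERY `ψ ∈ C_c^∞(B)` supported in `U_i` the `H`-side realises the box values of `RHS_ψ` in `PH` with vanishing off the box (`hreal`) and `RHS_ψ` vanishes at the regular `γ_H`
not stably matched into the box (`hzeroG`); plus the additivity ∕ finiteness side conditions of ★ `exists_transfer_of_cover`.  Then `φ` has a Δ-transfer in `PH`.
[cite: Rogawski1990, §4.9 Prop. 4.9.1 (a) pp. 54–55] [cite: LanglandsShelstad1987, §1.3–1.4] -/
theorem exists_transfer_of_cover_of_charts {R : A → B → Prop} {stA : A → A → Prop} {regA : A → Prop} {T : TransferFactorData A B R}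
    {mH : OrbitalMeasureFamily A} {mG : OrbitalMeasureFamily B}
    (hsymm : ∀ a a', stA a a' → stA a' a) (htrans : ∀ a a' a'', stA a a' → stA a' a'' → stA a a'')
    (hΔst : ∀ (a a' : A) (b : B), stA a a' → T.Δ a' b = T.Δ a b)
    {ι : Type*} (U : ι → Set B) (hU : ∀ i, IsOpen (U i))
    (PH : (A → ℂ) → Prop) (hPH0 : PH 0) (hPHadd : ∀ F G, PH F → PH G → PH (F + G))
    (hA : ∀ a, regA a → ∀ F G, PH F → PH G →
      stableOrbitalIntegralRel stA mH (F + G) a = stableOrbitalIntegralRel stA mH F a + stableOrbitalIntegralRel stA mH G a)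
    (hfin : ∀ F : B → ℂ, IsLocSmooth F → ∀ a, regA a →
      (Function.support fun c : ConjClasses B => T.Δ a (Quotient.out c) * classOrbitalIntegral mG F c).Finite)
    (hB : ∀ a, regA a → ∀ c : ConjClasses B, T.Δ a (Quotient.out c) ≠ 0 → ∀ F G : B → ℂ, IsLocSmooth F → IsLocSmooth G →
      classOrbitalIntegral mG (F + G) c = classOrbitalIntegral mG F c + classOrbitalIntegral mG G c)
    {Bx : ι → Type*} (τ : ∀ i, Bx i → A) (Bb : ∀ i, Set (Bx i))
    (hreal : ∀ i (ψ : B → ℂ), IsLocSmooth ψ → tsupport ψ ⊆ U i → ∃ ψH : A → ℂ, PH ψH ∧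
      (∀ b ∈ Bb i, stableOrbitalIntegralRel stA mH ψH (τ i b) = ∑ᶠ c : ConjClasses B, T.Δ (τ i b) (Quotient.out c) * classOrbitalIntegral mG ψ c) ∧
      (∀ a, regA a → (∀ b ∈ Bb i, ¬ stA a (τ i b)) → stableOrbitalIntegralRel stA mH ψH a = 0))
    (hzeroG : ∀ i (ψ : B → ℂ), IsLocSmooth ψ → tsupport ψ ⊆ U i →
      ∀ a, regA a → (∀ b ∈ Bb i, ¬ stA a (τ i b)) → ∑ᶠ c : ConjClasses B, T.Δ a (Quotient.out c) * classOrbitalIntegral mG ψ c = 0)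
    (φ : B → ℂ) (hφ : IsLocSmooth φ) (hcov : tsupport φ ⊆ ⋃ i, U i) :
    ∃ φH : A → ℂ, PH φH ∧ IsDeltaTransferRel R stA regA T mH mG φH φ :=
  exists_transfer_of_cover U hU PH hPH0 hPHadd hA hfin hB
    (fun i ψ hψ hψU => exists_transfer_of_chart hsymm htrans hΔst PH (τ i) (Bb i) ψ (hreal i ψ hψ hψU) (hzeroG i ψ hψ hψU))
    φ hφ hcov

/-- **The `IsDeltaTransferExistsRel` form**: charts with boxes covering every `tsupport` ⇒ ★ `IsDeltaTransferExistsRel … IsLocSmooth PH`.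
[cite: Rogawski1990, §4.9 Prop. 4.9.1 (a) p. 55] -/
theorem isDeltaTransferExistsRel_of_charts {R : A → B → Prop} {stA : A → A → Prop} {regA : A → Prop} {T : TransferFactorData A B R}
    {mH : OrbitalMeasureFamily A} {mG : OrbitalMeasureFamily B}
    (hsymm : ∀ a a', stA a a' → stA a' a) (htrans : ∀ a a' a'', stA a a' → stA a' a'' → stA a a'')
    (hΔst : ∀ (a a' : A) (b : B), stA a a' → T.Δ a' b = T.Δ a b)
    {ι : Type*} (U : ι → Set B) (hU : ∀ i, IsOpen (U i))
    (PH : (A → ℂ) → Prop) (hPH0 : PH 0) (hPHadd : ∀ F G, PH F → PH G → PH (F + G))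
    (hA : ∀ a, regA a → ∀ F G, PH F → PH G →
      stableOrbitalIntegralRel stA mH (F + G) a = stableOrbitalIntegralRel stA mH F a + stableOrbitalIntegralRel stA mH G a)
    (hfin : ∀ F : B → ℂ, IsLocSmooth F → ∀ a, regA a →
      (Function.support fun c : ConjClasses B => T.Δ a (Quotient.out c) * classOrbitalIntegral mG F c).Finite)
    (hB : ∀ a, regA a → ∀ c : ConjClasses B, T.Δ a (Quotient.out c) ≠ 0 → ∀ F G : B → ℂ, IsLocSmooth F → IsLocSmooth G →
      classOrbitalIntegral mG (F + G) c = classOrbitalIntegral mG F c + classOrbitalIntegral mG G c)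
    {Bx : ι → Type*} (τ : ∀ i, Bx i → A) (Bb : ∀ i, Set (Bx i))
    (hreal : ∀ i (ψ : B → ℂ), IsLocSmooth ψ → tsupport ψ ⊆ U i → ∃ ψH : A → ℂ, PH ψH ∧
      (∀ b ∈ Bb i, stableOrbitalIntegralRel stA mH ψH (τ i b) = ∑ᶠ c : ConjClasses B, T.Δ (τ i b) (Quotient.out c) * classOrbitalIntegral mG ψ c) ∧
      (∀ a, regA a → (∀ b ∈ Bb i, ¬ stA a (τ i b)) → stableOrbitalIntegralRel stA mH ψH a = 0))
    (hzeroG : ∀ i (ψ : B → ℂ), IsLocSmooth ψ → tsupport ψ ⊆ U i →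
      ∀ a, regA a → (∀ b ∈ Bb i, ¬ stA a (τ i b)) → ∑ᶠ c : ConjClasses B, T.Δ a (Quotient.out c) * classOrbitalIntegral mG ψ c = 0)
    (hcov : ∀ φ : B → ℂ, IsLocSmooth φ → tsupport φ ⊆ ⋃ i, U i) :
    IsDeltaTransferExistsRel R stA regA T mH mG IsLocSmooth PH :=
  fun φ hφ => exists_transfer_of_cover_of_charts hsymm htrans hΔst U hU PH hPH0 hPHadd hA hfin hB τ Bb hreal hzeroG φ hφ (hcov φ hφ)

end Charts

end Literature.NumberTheory.Rogawski1990

end
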